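import Literature.Computability.MetaComplexity.ProofSystemsProofs
import HarnessLib

/-!
# Krajíček's criterion: a map is hard for all proof systems iff its range meets every infinite `NP` set

Language-level form of Krajíček's Lemma 19.4.1 (*Proof complexity*, CUP 2019, §19.4, p. 420;
also arXiv:2208.11642, §1): for a map `g : {0,1}* → {0,1}*`, the following are equivalent —

* (hardness for all proof systems) for every polynomial-time verifier `V` that is SOUND for the
  complement of the range of `g` (`V b π ⇒ b ∉ rng g`; i.e. every Cook–Reckhow proof system of a
  set of strings avoided by `g`) and every polynomial `p`, only finitely many `b` have a
  `V`-proof of length `≤ p(|b|)`;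
* (hitting) the range of `g` intersects every infinite `NP` language.

In the book the first clause is phrased through the propositional translations `τ(g)_b` of
"`b ∉ rng g`" and proof systems for `TAUT`; since `b ↦ τ(g)_b` is a polynomial-time injection with
`τ(g)_b ∈ TAUT ↔ b ∉ rng g`, proof systems for `TAUT` restricted to the `τ`-formulas are exactly
the sound verifiers for `(rng g)ᶜ` used here, so this is the same statement with the `τ`-layer
stripped (the tree has no `τ`-formulas yet). No hypothesis on `g` (stretching, polynomial time)
is needed for the equivalence itself.

Main results: `setOf_exists_short_proof_mem_NP` (the strings with short `V`-proofs form an `NP`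
set), `finite_short_proofs_of_range_hits_NP` (hitting ⇒ hardness),
`range_hits_NP_of_finite_short_proofs` (hardness ⇒ hitting), `range_hits_NP_iff_finite_short_proofs`.

Sources: J. Krajíček, *Proof complexity* (2019), Lemma 19.4.1; J. Krajíček, *On the existence of
strong proof complexity generators*, arXiv:2208.11642 (Bull. Symb. Logic 30 (2024)), §1.
Deliberately not here: `τ`-formulas, `P/poly` maps, the Krajíček–Razborov notions of
(pseudo-)surjectivity and iterability (Krajíček 2019, §19.4–19.6).
-/

namespace Literature.Computability.MetaComplexity

open _root_.Computability Complexity Complexity.Classes Complexity.Nondeterministic Polynomial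

variable {V : List Bool → List Bool → Bool}

/-- **Strings with short proofs form an `NP` set.** For a polynomial-time verifier `V` and a
polynomial `p`, `{x | ∃ π, |π| ≤ p(|x|) ∧ V x π}` is in `NP`: the witness language
`{⟨x, π⟩ | V x π}` is in `P` (the machine of `V` after the re-pairing machine
`polyTimeComputable_boolUnpair`, as in the proof of Cook–Reckhow's Prop. 1.4).
[cite: CookReckhow1979, §1 Prop. 1.4 (proof)] -/
theorem setOf_exists_short_proof_mem_NP (hV : IsPolyTimeVerifier V) (p : Polynomial ℕ) :
    ({x | ∃ π : List Bool, π.length ≤ p.eval x.length ∧ V x π = true} : Language Bool) ∈ NP := by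
  set L' : Language Bool := {w | Function.uncurry V (boolUnpair w) = true} with hL'
  have hL'P : L' ∈ P := by
    refine mem_P_iff_holds.2 (polyTimeDecidable_iff.2 ?_)
    have hcomp : PolyTimeComputable (id : List Bool → List Bool) encodeBool
        (Function.uncurry V ∘ boolUnpair) :=
      PolyTimeComputable.comp_holds hV polyTimeComputable_boolUnpair
    have hind : L'.boolIndicator = Function.uncurry V ∘ boolUnpair := by
      funext w
      by_cases hw : Function.uncurry V (boolUnpair w) = true
      · rw [(Set.mem_iff_boolIndicator L' w).1 hw]
        exact hw.symm
      · rw [(Set.notMem_iff_boolIndicator L' w).1 hw]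
        simp only [Function.comp_apply]
        cases h : Function.uncurry V (boolUnpair w)
        · rfl
        · exact absurd h hw
    rw [hind]
    exact hcomp
  have hmem : ∀ x π : List Bool, boolPair x π ∈ L' ↔ V x π = true := fun x π => by
    change Function.uncurry V (boolUnpair (boolPair x π)) = true ↔ _
    rw [boolUnpair_boolPair]
    rfl
  refine ⟨L', hL'P, p, fun x => ?_⟩
  show (∃ π : List Bool, π.length ≤ p.eval x.length ∧ V x π = true) ↔ _
  simp only [hmem]

/-- The indicator verifier `V x π := [⟨x, π⟩ ∈ W]` of a language `W ∈ P` of pairs is a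
polynomial-time verifier. [folklore] -/
theorem isPolyTimeVerifier_boolIndicator_of_mem_P {W : Language Bool} (hW : W ∈ P) :
    IsPolyTimeVerifier fun x π => W.boolIndicator (boolPair x π) := by
  obtain ⟨q, M, hM⟩ := polyTimeDecidable_iff.1 (mem_P_iff_holds.1 hW)
  exact ⟨q, M, fun pr => hM (boolPair pr.1 pr.2)⟩

/-- **Krajíček's Lemma 19.4.1, (hitting ⇒ hardness).** If the range of `g` meets every infinite
`NP` language, then every polynomial-time verifier sound for `(rng g)ᶜ` has, for each polynomial
`p`, only finitely many strings with proofs of length `≤ p(|b|)` — the set of such strings is an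
`NP` set avoided by the range. [cite: KrajicekProofComplexity2019, Lemma 19.4.1] -/
theorem finite_short_proofs_of_range_hits_NP {g : List Bool → List Bool}
    (hhit : ∀ L ∈ NP, L.Infinite → ∃ x, g x ∈ L)
    (hV : IsPolyTimeVerifier V) (hsound : ∀ b π, V b π = true → b ∉ Set.range g)
    (p : Polynomial ℕ) :
    ({b | ∃ π : List Bool, π.length ≤ p.eval b.length ∧ V b π = true} : Set (List Bool)).Finite := by
  by_contra hinf
  obtain ⟨x, π, -, hπ⟩ := hhit _ (setOf_exists_short_proof_mem_NP hV p) hinf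
  exact hsound _ _ hπ ⟨x, rfl⟩

/-- **Krajíček's Lemma 19.4.1, (hardness ⇒ hitting).** If every polynomial-time verifier sound
for `(rng g)ᶜ` proves only finitely many strings within any polynomial length bound, then the
range of `g` meets every infinite `NP` language `L`: otherwise `L ⊆ (rng g)ᶜ`, and the
`NP`-verifier of `L` with its length test built in (`LenLe p ⊓ L' ∈ P`) is a sound verifier with
short proofs for every element of the infinite set `L`. [cite: KrajicekProofComplexity2019, Lemma 19.4.1] -/
theorem range_hits_NP_of_finite_short_proofs {g : List Bool → List Bool}
    (hhard : ∀ V : List Bool → List Bool → Bool, IsPolyTimeVerifier V →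
      (∀ b π, V b π = true → b ∉ Set.range g) → ∀ p : Polynomial ℕ,
        ({b | ∃ π : List Bool, π.length ≤ p.eval b.length ∧ V b π = true} : Set (List Bool)).Finite) :
    ∀ L ∈ NP, L.Infinite → ∃ x, g x ∈ L := by
  intro L hL hinf
  by_contra hno
  push Not at hno
  obtain ⟨L', hL', p, hp⟩ := hL
  set W : Language Bool := LenLe p ⊓ L' with hW
  have hWP : W ∈ P := inter_mem_P (LenLe_mem_P p) hL'
  have hmemW : ∀ x π : List Bool,
      boolPair x π ∈ W ↔ π.length ≤ p.eval x.length ∧ boolPair x π ∈ L' := fun x π => by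
    change boolPair x π ∈ LenLe p ∧ boolPair x π ∈ L' ↔ _
    rw [boolPair_mem_LenLe]
  let V : List Bool → List Bool → Bool := fun x π => W.boolIndicator (boolPair x π)
  have hVtrue : ∀ x π, V x π = true ↔ boolPair x π ∈ W := fun x π =>
    (Set.mem_iff_boolIndicator W (boolPair x π)).symm
  have hsound : ∀ b π, V b π = true → b ∉ Set.range g := by
    rintro b π h ⟨x, rfl⟩
    have hb : g x ∈ L := (hp (g x)).2 ⟨π, ((hmemW _ _).1 ((hVtrue _ _).1 h)).1,
      ((hmemW _ _).1 ((hVtrue _ _).1 h)).2⟩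
    exact hno x hb
  have hfin := hhard V (isPolyTimeVerifier_boolIndicator_of_mem_P hWP) hsound p
  apply hinf
  refine hfin.subset fun b hb => ?_
  obtain ⟨y, hy, hyL⟩ := (hp b).1 hb
  exact ⟨y, hy, (hVtrue b y).2 ((hmemW b y).2 ⟨hy, hyL⟩)⟩

/-- **Krajíček's Lemma 19.4.1** (language-level form): the range of `g` meets every infinite `NP`
language iff every polynomial-time verifier sound for `(rng g)ᶜ` proves, within any polynomial
length bound, only finitely many strings ("`g` is hard for all proof systems").
[cite: KrajicekProofComplexity2019, Lemma 19.4.1] -/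
theorem range_hits_NP_iff_finite_short_proofs (g : List Bool → List Bool) :
    (∀ L ∈ NP, L.Infinite → ∃ x, g x ∈ L) ↔
      ∀ V : List Bool → List Bool → Bool, IsPolyTimeVerifier V →
        (∀ b π, V b π = true → b ∉ Set.range g) → ∀ p : Polynomial ℕ,
          ({b | ∃ π : List Bool, π.length ≤ p.eval b.length ∧ V b π = true} :
            Set (List Bool)).Finite :=
  ⟨fun h _ hV hs p => finite_short_proofs_of_range_hits_NP h hV hs p,
    range_hits_NP_of_finite_short_proofs⟩

/-- The same criterion phrased with Cook–Reckhow proof systems: the range of `g` meets every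
infinite `NP` language iff for every language `L` avoided by the range (`L ⊆ (rng g)ᶜ`) and every
proof system `V` for `L`, each polynomial length bound admits proofs of only finitely many members
of `L`. [cite: KrajicekProofComplexity2019, Lemma 19.4.1] -/
theorem range_hits_NP_iff_proofSystems_finite (g : List Bool → List Bool) :
    (∀ L ∈ NP, L.Infinite → ∃ x, g x ∈ L) ↔
      ∀ (L : Language Bool) (V : List Bool → List Bool → Bool), (∀ b ∈ L, b ∉ Set.range g) →
        IsProofSystemFor V L → ∀ p : Polynomial ℕ,
          ({b | ∃ π : List Bool, π.length ≤ p.eval b.length ∧ V b π = true} :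
            Set (List Bool)).Finite := by
  rw [range_hits_NP_iff_finite_short_proofs]
  constructor
  · intro h L V hL hV p
    exact h V hV.1 (fun b π hπ => hL b (hV.mem_of_eq_true hπ)) p
  · intro h V hV hs p
    refine h {b | ∃ π, V b π = true} V (fun b ⟨π, hπ⟩ => hs b π hπ) ⟨hV, fun b => Iff.rfl⟩ p

end Literature.Computability.MetaComplexity
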